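import Summits.BirchSwinnertonDyer.Rank1Residual.Supersingular.MazurTateReduction
import Literature.NumberTheory.EllipticCurves.Sprung2017.SharpFlatPAdicLFunctionUniqueProofs
import Literature.NumberTheory.EllipticCurves.Kobayashi2003.SignedPAdicLFunctionUniqueProofs
import HarnessLib

/-!
# Reading `(μ, λ)` of Sprung's `L♯`, `L♭` (and Pollack's `L^±`) off ONE Mazur–Tate element of `E`:
# the census's `λ(θ_n)` CERTIFIES the squeeze binders `μ(L^•) = 0`, `λ(L^•) = l`
# (cell `b2b-bsdres`, supersingular family, prover B = unit `b2b-bsdres-additive-p3`, gen 4; part 2/2)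

HONEST FRAMING (run/shared/lean/b2b/bsd-rank1-residual/, verbatim in every file): the goal of the
cell is to DELETE the COMBINATION-SHAPED residual classes of the Birch–Swinnerton-Dyer formula for
ALL analytic-rank `≤ 1` elliptic curves over `ℚ` — "full BSD formula for every rank `≤ 1` curve in
class `C`" assembled STRICTLY from published theorems — so that the rank-`≤ 1` remainder becomes
exactly the CONSTRUCTION-SHAPED classes, which are TYPED (missing-input `Prop`s), NOT attempted.
This is not "finishing BSD". THEOREMS ONLY (no definition, no named fact; nothing about any curve
is asserted; nothing booked; labels unchanged). PER PAIR bookkeeping for the census's certificates.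

## What this file proves (part 2; the mod-`p` readings are part 1, `MazurTateReduction.lean`)

* `exists_integral_mazurTate_of_isSprungPair` — for `p ≠ 2`, `f` the newform of `E`, good reduction
  with `p ∣ a_p`, and ANY Sprung pair `(L♯, L♭)` — THE pair: existence
  `Sprung2017.thm112_exists_isSprungPair_holds` (p213581, integral: `exists_integral_isSprungPair`)
  + UNIQUENESS `Sprung2017.IsSprungPair.unique` (p214240) —, every Mazur–Tate element is
  `θ_n = ι(ω_n Q_n − (u_n L♯ + v_n L♭))` with `Q_n ∈ Λ`: `θ_n` IS an element of `Λ` of the shape read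
  in part 1;
* **`lam_sharp_eq_of_mazurTate` / `lam_flat_eq_of_mazurTate`**: hence the census bit — "`θ_n`, as an
  element `Θ ∈ Λ`, is non-zero with `μ(Θ) = 0` and `λ(Θ) = deg ω_n^+ + l < pⁿ` at some ODD `n`" (two
  engines) — CERTIFIES `μ(L♯) = 0 ∧ λ(L♯) = l`; EVEN `n` with `deg ω_n^-` certifies `(μ, λ)(L♭)`.
  At `l = 1` these are exactly the binders `hμ, hlam` / `hcert` of the rank-one squeezes
  (`SignedSqueeze` X8 readings: 18 pairs; `SharpFlatConverseReal`);
* **`lam_signed_neg_one_eq_of_mazurTate` / `lam_signed_one_eq_of_mazurTate`**: at `a_p = 0`, for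
  harvest-2's `Kobayashi2003.IsSignedPAdicLFunction f p ε L` (Kobayashi's labelling: `ε = −1` ↔ odd
  levels ↔ the tree's `L⁺ = L♯`; `ε = 1` ↔ even levels ↔ `L⁻ = L♭`; Pollack's theorem
  `pollack_exists_plusMinusPAdicLFunction_holds` + `IsSignedPAdicLFunction.unique` +
  `isSprungPair_zero_iff`) the same certificates — the `hcert` of
  `kobayashiMainConjecture_of_lam_eq_one_of_analyticRank_eq_one` (X7/X6: 31 rank-one pairs).

So the supersingular census columns `(λ♯, λ♭)` / `(λ⁺, λ⁻)` (iw-2, IWASAWA-CENSUS §6.3, read "via Sprung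
ANT 2017 Cor. 3.6") are now tied to the tree objects by THEOREMS: what an engine must certify per
pair is `μ(θ_n) = 0` and the index `λ(θ_n)` of the first unit coefficient of ONE `p`-integral
polynomial `θ_n` of degree `< pⁿ`, `n` of the right parity with `λ(θ_n) < pⁿ`.

References: [Sprung2017] Thm. 1.12, §3 (invariants `μ_±, λ_±`), Cor. 3.6, Cor. 4.4, Cor. 4.10;
[Pollack2003] Prop. 6.9, 6.10, 6.18; [Kobayashi2003] (3.4)–(3.6) (p. 7), Thm. 1.4;
[GreenbergVatsal2000] p. 4. Memo: `HOME/b2b-bsdres-additive-p3/X8-ROUTE-B.md` §9 (gen 4).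
-/

set_option autoImplicit false

noncomputable section

open scoped Classical MatrixGroups ModularForm

open CongruenceSubgroup Polynomial WeierstrassCurve Literature.NumberTheory.EllipticCurves
  Literature.NumberTheory.EllipticCurves.ModularForms
  Literature.NumberTheory.EllipticCurves.Sprung2017
  Summit.BirchSwinnertonDyer.Rank1Residual.X1.MuLambda

namespace Summit.BirchSwinnertonDyer.Rank1Residual.Supersingular

/-! ## §4. The Mazur–Tate elements of `E` as elements of `Λ`, for THE Sprung pair -/

section Integral

variable {W : WeierstrassCurve ℚ} [W.IsElliptic] [W.IsGloballyMinimal] {N : ℕ} [NeZero N]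
  {f : CuspForm (Gamma0 N) 2} {p : ℕ} [hp : Fact p.Prime]

/-- **Every Mazur–Tate element is INTEGRALLY congruent to `−(u_n L♯ + v_n L♭)` for THE Sprung
pair.** For `p ≠ 2`, `f` the newform of `E = W`, good reduction with `p ∣ a_p`, and ANY Sprung pair
`(L♯, L♭)` (= the unique one, `IsSprungPair.unique`; the integral one of
`exists_integral_isSprungPair`): for every `n` there is `Q_n ∈ Λ` with
`θ_n = ι(ω_n Q_n − (u_n L♯ + v_n L♭))` in `ℚ_p⟦T⟧` — the Mazur–Tate element IS an element of `Λ` of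
the shape used by the readings of §3. [cite: Sprung2017, Thm. 1.12, Cor. 4.4 and Cor. 4.10] -/
theorem exists_integral_mazurTate_of_isSprungPair (hp2 : p ≠ 2) (hf : IsNewformOf W f)
    (hgood : W.HasGoodReductionAtPrime p) (hap : (p : ℤ) ∣ W.frobeniusTrace p)
    {Lsharp Lflat : IwasawaAlgebra p} (hSP : IsSprungPair f p (W.frobeniusTrace p) Lsharp Lflat)
    (n : ℕ) :
    ∃ Q : IwasawaAlgebra p, ((mazurTateElement f p n).map (algebraMap ℚ ℚ_[p]) : PowerSeries ℚ_[p]) =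
      iwasawaToPowerSeries p (toIwasawa p (cyclotomicOmega p n) * Q -
        (toIwasawa p (sharpPoly (W.frobeniusTrace p) p n) * Lsharp +
          toIwasawa p (flatPoly (W.frobeniusTrace p) p n) * Lflat)) := by
  obtain ⟨Ls, Lf, hLsLf⟩ := exists_integral_isSprungPair hp2 hf.1 hf.coeffField_eq_bot
    (not_dvd_level_of_isNewformOf hf hgood) (cuspCoeff_eq_frobeniusTrace_of_isNewformOf_holds hf hgood)
    hap
  -- `(Ls, Lf)` is a Sprung pair, hence equal to `(Lsharp, Lflat)`
  have hSP' : IsSprungPair f p (W.frobeniusTrace p) Ls Lf := by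
    intro m
    obtain ⟨Q, hQ⟩ := hLsLf m
    refine ⟨0, Q, ?_⟩
    rw [pow_zero, map_one, one_mul, Polynomial.map_neg, Polynomial.map_one, Polynomial.coe_neg,
      Polynomial.coe_one, neg_one_mul, map_neg, sub_neg_eq_add, hQ]
  obtain ⟨h1, h2⟩ := hSP.unique hap hSP'
  subst h1 h2
  obtain ⟨Q, hQ⟩ := hLsLf n
  refine ⟨Q, ?_⟩
  rw [map_sub, toIwasawa_apply (p := p) (cyclotomicOmega p n), ← hQ]
  ring

end Integral

/-! ## §5. The census certificates: `λ(θ_n)` CERTIFIES `(μ, λ)(L^•)` -/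

section Certificates

variable {W : WeierstrassCurve ℚ} [W.IsElliptic] [W.IsGloballyMinimal] {N : ℕ} [NeZero N]
  {f : CuspForm (Gamma0 N) 2} {p : ℕ} [hp : Fact p.Prime]

/-- **`(μ, λ)(L♯)` from ONE odd-level Mazur–Tate invariant.** At an odd supersingular prime
(`p ≠ 2`, good, `p ∣ a_p`), for the newform `f` of `E` and ANY Sprung pair `(L♯, L♭)`: if for some
odd `n` the Mazur–Tate element `θ_n`, as the element `Θ ∈ Λ` with `ι Θ = θ_n` (it exists:
`exists_integral_mazurTate_of_isSprungPair`), is non-zero with `μ(Θ) = 0` and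
`λ(Θ) = deg ω_n^+ + l < pⁿ` — the two-engine datum of the census —, then `μ(L♯) = 0` and
`λ(L♯) = l`. (At `l = 1`: the binder `hμ/hlam` of the rank-one squeezes for the colour `♯`.)
[cite: Pollack2003, Prop. 6.9 and Prop. 6.10] [cite: Sprung2017, §3 and Cor. 3.6, Thm. 1.12] -/
theorem lam_sharp_eq_of_mazurTate (hp2 : p ≠ 2) (hf : IsNewformOf W f)
    (hgood : W.HasGoodReductionAtPrime p) (hap : (p : ℤ) ∣ W.frobeniusTrace p)
    {Lsharp Lflat : IwasawaAlgebra p} (hSP : IsSprungPair f p (W.frobeniusTrace p) Lsharp Lflat)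
    {n : ℕ} (hn : Odd n) {Θ : IwasawaAlgebra p}
    (hΘ : iwasawaToPowerSeries p Θ =
      ((mazurTateElement f p n).map (algebraMap ℚ ℚ_[p]) : PowerSeries ℚ_[p]))
    (hΘ0 : Θ ≠ 0) (hμ : mu Θ = 0) {l : ℕ}
    (hlam : lam Θ = (cyclotomicOmegaPlus p n).natDegree + l) (hlt : lam Θ < p ^ n) :
    mu Lsharp = 0 ∧ lam Lsharp = l := by
  obtain ⟨Q, hQ⟩ := exists_integral_mazurTate_of_isSprungPair hp2 hf hgood hap hSP n
  have hΘeq := iwasawaToPowerSeries_injective p (hΘ.trans hQ)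
  obtain ⟨hμA, hlamA⟩ := mu_eq_zero_and_lam_add_eq_of_odd hap hn hΘeq hΘ0 hμ hlt
  exact ⟨hμA, by omega⟩

/-- **`(μ, λ)(L♭)` from ONE even-level Mazur–Tate invariant**: same with `n` even, `deg ω_n^-`.
[cite: Pollack2003, Prop. 6.9 and Prop. 6.10] [cite: Sprung2017, §3 and Cor. 3.6, Thm. 1.12] -/
theorem lam_flat_eq_of_mazurTate (hp2 : p ≠ 2) (hf : IsNewformOf W f)
    (hgood : W.HasGoodReductionAtPrime p) (hap : (p : ℤ) ∣ W.frobeniusTrace p)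
    {Lsharp Lflat : IwasawaAlgebra p} (hSP : IsSprungPair f p (W.frobeniusTrace p) Lsharp Lflat)
    {n : ℕ} (hn : Even n) {Θ : IwasawaAlgebra p}
    (hΘ : iwasawaToPowerSeries p Θ =
      ((mazurTateElement f p n).map (algebraMap ℚ ℚ_[p]) : PowerSeries ℚ_[p]))
    (hΘ0 : Θ ≠ 0) (hμ : mu Θ = 0) {l : ℕ}
    (hlam : lam Θ = (cyclotomicOmegaMinus p n).natDegree + l) (hlt : lam Θ < p ^ n) :
    mu Lflat = 0 ∧ lam Lflat = l := by
  obtain ⟨Q, hQ⟩ := exists_integral_mazurTate_of_isSprungPair hp2 hf hgood hap hSP n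
  have hΘeq := iwasawaToPowerSeries_injective p (hΘ.trans hQ)
  obtain ⟨hμB, hlamB⟩ := mu_eq_zero_and_lam_add_eq_of_even hap hn hΘeq hΘ0 hμ hlt
  exact ⟨hμB, by omega⟩

end Certificates

/-! ## §6. `a_p = 0`: the same readings for Pollack's `L^±` in Kobayashi's labelling -/

section Signed

variable {W : WeierstrassCurve ℚ} [W.IsElliptic] [W.IsGloballyMinimal] {N : ℕ} [NeZero N]
  {f : CuspForm (Gamma0 N) 2} {p : ℕ} [hp : Fact p.Prime]

open Literature.NumberTheory.EllipticCurves.Kobayashi2003 in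
/-- **`a_p = 0`, sign `ε = −1` (Kobayashi's `L_p^-` = the tree's `L⁺`, ODD levels): `(μ, λ)` from one
odd-level Mazur–Tate invariant.** For `p ≠ 2` good with `a_p = 0`, `f` the newform of `E`, and ANY
`L` with `IsSignedPAdicLFunction f p (-1) L` (unique, and = the `♯`-component of the Sprung pair at
`a_p = 0` by `isSprungPair_zero_iff` + Pollack's theorem `pollack_exists_plusMinusPAdicLFunction_holds`):
a non-zero `Θ ∈ Λ` with `ι Θ = θ_n`, `n` odd, `μ(Θ) = 0`, `λ(Θ) = deg ω_n^+ + l < pⁿ` gives `μ(L) = 0`,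
`λ(L) = l` — Pollack's Prop. 6.9/6.10 as a certificate (the `hcert` of
`kobayashiMainConjecture_of_lam_eq_one_of_analyticRank_eq_one` at `l = 1`, `ε = −1`).
[cite: Pollack2003, Prop. 6.9, Prop. 6.10 and Prop. 6.18] [cite: Kobayashi2003, (3.4)–(3.5) (p. 7)] -/
theorem lam_signed_neg_one_eq_of_mazurTate (hp2 : p ≠ 2) (hf : IsNewformOf W f)
    (hgood : W.HasGoodReductionAtPrime p) (hap : W.frobeniusTrace p = 0)
    {L : IwasawaAlgebra p} (hL : IsSignedPAdicLFunction f p (-1) L)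
    {n : ℕ} (hn : Odd n) {Θ : IwasawaAlgebra p}
    (hΘ : iwasawaToPowerSeries p Θ =
      ((mazurTateElement f p n).map (algebraMap ℚ ℚ_[p]) : PowerSeries ℚ_[p]))
    (hΘ0 : Θ ≠ 0) (hμ : mu Θ = 0) {l : ℕ}
    (hlam : lam Θ = (cyclotomicOmegaPlus p n).natDegree + l) (hlt : lam Θ < p ^ n) :
    mu L = 0 ∧ lam L = l := by
  obtain ⟨Lplus, Lminus, -, -, hodd, heven⟩ :=
    pollack_exists_plusMinusPAdicLFunction_holds (W := W) (f := f) (p := p) hp2 hf hgood hap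
  have hSP : IsSprungPair f p (W.frobeniusTrace p) Lplus Lminus := by
    rw [hap]
    exact (isSprungPair_zero_iff f p Lplus Lminus).mpr ⟨hodd, heven⟩
  have hLeq : L = Lplus := hL.unique ((isSignedPAdicLFunction_neg_one_iff f p Lplus).mpr hodd)
  subst hLeq
  have hap' : (p : ℤ) ∣ W.frobeniusTrace p := by rw [hap]; exact dvd_zero _
  exact lam_sharp_eq_of_mazurTate hp2 hf hgood hap' hSP hn hΘ hΘ0 hμ hlam hlt

open Literature.NumberTheory.EllipticCurves.Kobayashi2003 in
/-- **`a_p = 0`, sign `ε = 1` (Kobayashi's `L_p^+` = the tree's `L⁻`, EVEN levels)**: the same with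
`n` even and `deg ω_n^-`. [cite: Pollack2003, Prop. 6.9, Prop. 6.10 and Prop. 6.18] [cite: Kobayashi2003, (3.4)–(3.5) (p. 7)] -/
theorem lam_signed_one_eq_of_mazurTate (hp2 : p ≠ 2) (hf : IsNewformOf W f)
    (hgood : W.HasGoodReductionAtPrime p) (hap : W.frobeniusTrace p = 0)
    {L : IwasawaAlgebra p} (hL : IsSignedPAdicLFunction f p 1 L)
    {n : ℕ} (hn : Even n) {Θ : IwasawaAlgebra p}
    (hΘ : iwasawaToPowerSeries p Θ =
      ((mazurTateElement f p n).map (algebraMap ℚ ℚ_[p]) : PowerSeries ℚ_[p]))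
    (hΘ0 : Θ ≠ 0) (hμ : mu Θ = 0) {l : ℕ}
    (hlam : lam Θ = (cyclotomicOmegaMinus p n).natDegree + l) (hlt : lam Θ < p ^ n) :
    mu L = 0 ∧ lam L = l := by
  obtain ⟨Lplus, Lminus, -, -, hodd, heven⟩ :=
    pollack_exists_plusMinusPAdicLFunction_holds (W := W) (f := f) (p := p) hp2 hf hgood hap
  have hSP : IsSprungPair f p (W.frobeniusTrace p) Lplus Lminus := by
    rw [hap]
    exact (isSprungPair_zero_iff f p Lplus Lminus).mpr ⟨hodd, heven⟩
  have hLeq : L = Lminus := hL.unique ((isSignedPAdicLFunction_one_iff f p Lminus).mpr heven)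
  subst hLeq
  have hap' : (p : ℤ) ∣ W.frobeniusTrace p := by rw [hap]; exact dvd_zero _
  exact lam_flat_eq_of_mazurTate hp2 hf hgood hap' hSP hn hΘ hΘ0 hμ hlam hlt

end Signed

end Summit.BirchSwinnertonDyer.Rank1Residual.Supersingular

end
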